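import Summits.HodgeConjecture.FermatCycles.ConditionQFourfoldSearch
import Summits.HodgeConjecture.FermatCycles.ConditionQFourfoldSeventyTwoTable
import HarnessLib

/-!
# Shioda's stable-generation condition `(Q⁴ₘ)` at `m = 72` — kernel certificate (part A of 4)

HONEST FRAMING: explicit algebraic cycles for specific Hodge classes on Fermat/Delsarte varieties;
residual open instances listed; no claim on general Hodge.

Topic path `Summits/HodgeConjecture/FermatCycles/` of cell `pub-hfermat` (new work, not literature: a computer determination of the cell —
`pub-hfermat-enum/P4-TABLE.md` §(Q⁴ₘ), two implementations — certified by the Lean kernel). Framework: `ConditionQFourfold.lean`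
(certificate Booleans, searches `checkQU`/`checkQN`) and `ConditionQFourfoldSearch.lean` (`conditionQ_four_of_normalized`).

THE STATEMENT. Shioda, Math. Ann. 245 (1979) §4 p. 183: `(Qⁿₘ)` — every element of `Mₘ(y)`, `3 ≤ y ≤ n/2 + 1`, is `ξ₁ − ξ₂` with
`ξ₁, ξ₂ ∈ M'ₘ = ⟨Mₘ(1), Mₘ(2), Mₘ(3)^sd⟩` (pairs, Hodge classes of the Fermat surface, semi-decomposable sextuples); by his Claim
(p. 183, Lemmas 2–3) `(Qⁿₘ)` may replace `(Pⁿₘ)` in Theorem III (`⇒` the Hodge conjecture for `Xⁿₘ`); p. 184: "we do not know any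
value of `m` which satisfies `(Qₘ)` but not `(Pₘ)`". Tree: `Literature.AlgebraicGeometry.Shioda1979.ConditionQ m n`, `MPrime`,
`forall_of_conditionQ` (the Claim's arithmetic spine), `ConditionP` (Math. Ann. form of `(P)`), `FermatCharacter.ShiodaConditionUpTo`
(Proc. Japan Acad. form, with the semi-decomposable alternative).

WHAT IS PROVED HERE (level `m = 72`, part A).
* part A of 4: the kernel searches `checkQU 72 T 1 18`, `checkQU 72 T 19 53` (110816 tuples);

NUMBERS (this seat's search `code/lit/q4/q4norm.py` = implementation 2; implementation 1 = ENUM `code/enum/q4table.py`,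
`data/shioda_Q4_m3-100.json`): case U visits 110816 sorted tuples and case N 227250; 8862 of them are Hodge sextuples; all but 159 carry a
`(P)`-witness (case N pair 6152, case N quasi 1282, case N semi 232, case U pair 951, case U quasi 81, case U semi 5); the other 159 — `(1, 6, 11, 59, 69, 70)` (case U); `(1, 10, 25, 57, 59, 64)` (case U); `(1, 10, 37, 50, 52, 66)` (case U); `(1, 10, 37, 50, 54, 64)` (case U); `(1, 10, 37, 54, 56, 58)` (case U); `(1, 11, 18, 57, 59, 70)` (case U); `(1, 11, 24, 51, 59, 70)` (case U); `(1, 11, 26, 50, 59, 69)` (case U); `(1, 11, 38, 51, 56, 59)` (case U); `(1, 11, 39, 46, 49, 70)` (case U); `(1, 11, 39, 49, 50, 66)` (case U); `(1, 11, 40, 49, 57, 58)` (case U); `(1, 11, 48, 49, 50, 57)` (case U); `(1, 11, 49, 50, 51, 54)` (case U); `(1, 13, 37, 49, 50, 66)` (case U); `(1, 19, 37, 40, 55, 64)` (case U); `(1, 19, 37, 48, 55, 56)` (case U); `(1, 22, 25, 39, 59, 70)` (case U); `(1, 25, 26, 37, 61, 66)` (case U); `(1, 25, 26, 39, 59, 66)`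 (case U); `(1, 25, 26, 48, 57, 59)` (case U); `(1, 25, 26, 51, 54, 59)` (case U); `(1, 26, 28, 37, 58, 66)` (case U); `(1, 26, 33, 37, 50, 69)` (case U); `(1, 26, 37, 40, 54, 58)` (case U); `(1, 26, 37, 42, 50, 60)` (case U); `(1, 26, 37, 48, 50, 54)` (case U); `(2, 8, 26, 54, 58, 68)` (case N); `(2, 10, 21, 50, 64, 69)` (case N); `(2, 10, 21, 56, 58, 69)` (case N); `(2, 10, 21, 57, 58, 68)` (case N); `(2, 10, 24, 54, 58, 68)` (case N); `(2, 10, 24, 56, 58, 66)` (case N); `(2, 10, 27, 50, 63, 64)` (case N); `(2, 10, 27, 56, 58, 63)` (case N); `(2, 10, 28, 52, 58, 66)` (case N); `(2, 10, 28, 54, 58, 64)` (case N); `(2, 10, 32, 50, 54, 68)` (case N); `(2, 10, 33, 50, 52, 69)` (case N); `(2, 10, 33, 50, 57, 64)` (case N); `(2, 10, 33, 56, 57, 58)` (case N); `(2, 10, 36, 50, 54, 64)` (case N); `(2, 10, 36, 54, 56, 58)` (case N); `(2, 10, 40, 52, 54, 58)` (case N); `(2, 10, 42, 44, 50, 68)`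 (case N); `(2, 10, 42, 48, 50, 64)` (case N); `(2, 10, 44, 50, 54, 56)` (case N); `(2, 10, 48, 50, 52, 54)` (case N); `(2, 14, 38, 50, 52, 60)` (case N); `(2, 20, 26, 42, 58, 68)` (case N); `(2, 20, 26, 54, 56, 58)` (case N); `(2, 21, 26, 40, 58, 69)` (case N); `(2, 26, 27, 40, 58, 63)` (case N); `(2, 26, 28, 33, 58, 69)` (case N); `(2, 26, 28, 38, 60, 62)` (case N); `(2, 26, 28, 48, 54, 58)` (case N); `(2, 26, 33, 40, 57, 58)` (case N); `(2, 26, 36, 40, 54, 58)` (case N); `(2, 26, 40, 42, 48, 58)` (case N); `(2, 28, 30, 38, 52, 66)` (case N); `(3, 8, 22, 51, 62, 70)` (case N); `(3, 14, 16, 51, 62, 70)` (case N); `(3, 14, 32, 46, 51, 70)` (case N); `(3, 14, 38, 46, 51, 64)` (case N); `(3, 14, 39, 44, 46, 70)` (case N); `(3, 20, 22, 39, 62, 70)` (case N); `(3, 22, 38, 39, 46, 68)` (case N); `(3, 22, 38, 40, 51, 62)` (case N); `(3, 22, 38, 46, 51, 56)` (case N); `(4, 10, 34, 50, 52, 66)`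 (case N); `(4, 10, 34, 50, 54, 64)` (case N); `(4, 14, 15, 51, 62, 70)` (case N); `(4, 14, 18, 46, 64, 70)` (case N); `(4, 14, 18, 48, 62, 70)` (case N); `(4, 14, 26, 50, 60, 62)` (case N); `(4, 14, 30, 46, 52, 70)` (case N); `(4, 14, 30, 50, 52, 66)` (case N); `(4, 18, 22, 40, 62, 70)` (case N); `(4, 22, 28, 30, 62, 70)` (case N); `(4, 26, 28, 30, 62, 66)` (case N); `(4, 26, 28, 34, 58, 66)` (case N); `(4, 26, 33, 34, 50, 69)` (case N); `(4, 26, 34, 40, 54, 58)` (case N); `(4, 26, 34, 48, 50, 54)` (case N); `(6, 10, 42, 44, 46, 68)` (case N); `(6, 14, 16, 48, 62, 70)` (case N); `(6, 14, 20, 44, 62, 70)` (case N); `(6, 14, 38, 44, 46, 68)` (case N); `(6, 14, 38, 46, 48, 64)` (case N); `(6, 20, 22, 38, 62, 68)` (case N); `(6, 20, 22, 42, 58, 68)` (case N); `(6, 20, 34, 42, 44, 70)` (case N); `(6, 22, 38, 40, 48, 62)` (case N); `(8, 9, 22, 45, 62, 70)` (case N); `(8, 14, 18, 44, 62, 70)`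 (case N); `(8, 15, 22, 39, 62, 70)` (case N); `(8, 18, 22, 36, 62, 70)` (case N); `(8, 18, 22, 38, 62, 68)` (case N); `(8, 21, 26, 34, 58, 69)` (case N); `(8, 22, 24, 30, 62, 70)` (case N); `(8, 24, 26, 34, 58, 66)` (case N); `(8, 26, 27, 34, 58, 63)` (case N); `(8, 26, 33, 34, 57, 58)` (case N); `(8, 26, 34, 36, 54, 58)` (case N); `(8, 26, 34, 44, 50, 54)` (case N); `(9, 14, 16, 45, 62, 70)` (case N); `(9, 14, 32, 45, 46, 70)` (case N); `(9, 14, 38, 45, 46, 64)` (case N); `(9, 22, 38, 40, 45, 62)` (case N); `(9, 22, 38, 45, 46, 56)` (case N); `(10, 12, 22, 46, 58, 68)` (case N); `(10, 12, 34, 44, 46, 70)` (case N); `(10, 16, 34, 50, 52, 54)` (case N); `(10, 21, 32, 34, 50, 69)` (case N); `(10, 21, 34, 44, 50, 57)` (case N); `(10, 24, 32, 34, 50, 66)` (case N); `(10, 24, 34, 44, 50, 54)` (case N); `(10, 27, 32, 34, 50, 63)` (case N); `(10, 32, 33, 34, 50, 57)` (case N); `(10, 32, 34, 36, 50, 54)`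 (case N); `(12, 20, 22, 34, 58, 70)` (case N); `(14, 15, 16, 39, 62, 70)` (case N); `(14, 15, 32, 39, 46, 70)` (case N); `(14, 15, 38, 39, 46, 64)` (case N); `(14, 15, 38, 46, 51, 52)` (case N); `(14, 16, 18, 36, 62, 70)` (case N); `(14, 16, 18, 46, 52, 70)` (case N); `(14, 18, 20, 32, 62, 70)` (case N); `(14, 18, 24, 44, 46, 70)` (case N); `(14, 18, 32, 36, 46, 70)` (case N); `(14, 18, 32, 38, 46, 68)` (case N); `(14, 18, 36, 38, 46, 64)` (case N); `(14, 18, 38, 44, 46, 56)` (case N); `(14, 18, 38, 46, 48, 52)` (case N); `(14, 24, 30, 32, 46, 70)` (case N); `(15, 22, 28, 38, 51, 62)` (case N); `(15, 22, 38, 39, 40, 62)` (case N); `(15, 22, 38, 39, 46, 56)` (case N); `(16, 18, 22, 28, 62, 70)` (case N); `(16, 21, 26, 34, 50, 69)` (case N); `(16, 26, 27, 34, 50, 63)` (case N); `(16, 26, 28, 34, 54, 58)` (case N); `(16, 26, 33, 34, 50, 57)` (case N); `(16, 26, 34, 36, 50, 54)` (case N); `(16, 26, 34, 42, 48, 50)`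 (case N); `(18, 20, 22, 24, 62, 70)` (case N); `(18, 20, 22, 38, 56, 62)` (case N); `(18, 22, 24, 38, 46, 68)` (case N); `(18, 22, 28, 38, 46, 64)` (case N); `(18, 22, 28, 38, 48, 62)` (case N); `(18, 22, 36, 38, 40, 62)` (case N); `(18, 22, 36, 38, 46, 56)` (case N); `(18, 22, 38, 40, 46, 52)` (case N); `(20, 21, 26, 34, 57, 58)` (case N); `(20, 24, 26, 34, 54, 58)` (case N); `(20, 26, 32, 34, 50, 54)` (case N); `(20, 26, 34, 42, 44, 50)` (case N); `(22, 24, 30, 38, 46, 56)` (case N); `(22, 28, 30, 38, 46, 52)` (case N) — carry the table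
certificate(s) written out in the statements below (generators checked by `genB`, the identity `s + ΣX = ΣY` by `decide`, all inside the kernel search).

PRINT STATUS (lit seat, 2026-08-20). `72 = 2³·3²`: HC for every `Xⁿ₇₂` IS in print (Aoki 2000 Thm 0.1 (i), p. 185). The point of this level is Shioda's QUESTION (p. 184): `(Q⁴₇₂)` holds while `(P⁴₇₂)` fails; `72` has the second-largest certificate table of the twenty levels (159 sextuples without a `(P)`-witness; cell table, two implementations; kernel here).

References: [Shioda1979HodgeFermat] T. Shioda, Math. Ann. 245 (1979) 175–184, §3 p. 180 (`(Pⁿₘ)`), §4 pp. 183–184 (`M'ₘ`, `(Qⁿₘ)`, Claim,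
the question); [Shioda1979PJA] T. Shioda, Proc. Japan Acad. 55A (1979) §1 (Definition (i)–(iii), `(Pⁿₘ)'`); [daSilva2021HodgeFermat]
G. da Silva Jr., Experimental Results 2 (2021) e22, Def. 2.4, Question 1; [Aoki2000FermatTypeRemarks] N. Aoki, Comment. Math. Univ.
St. Pauli 49 (2000), Thm 0.1. Cell: `pub-hfermat-enum/P4-TABLE.md`, `data/shioda_Q4_m3-100.json`, `code/lit/q4/` (this seat).
-/

namespace Summit.HodgeConjecture.FermatCycles.ConditionQFourfold

open Multiset
open Literature.AlgebraicGeometry.HodgeTheory Literature.AlgebraicGeometry.HodgeTheory.FermatCharacter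
open Literature.AlgebraicGeometry.Shioda1982 Literature.AlgebraicGeometry.Shioda1979
open Summit.HodgeConjecture.FermatCycles.ShiodaConditionFourfold

/-! ### Level `72` — part A -/

/-! The certificate table at level `72` is the definition `table72` of `ConditionQFourfoldSeventyTwoTable.lean` (159 entries `(key, X, Y)`,
`s + ΣX = ΣY`; found by `code/lit/q4/q4norm.py`, every entry checked by the kernel inside the searches). -/

set_option maxHeartbeats 0 in
/-- The `(Q)`-search at level `72`, case U, first free representative in `[1, 19)` (66718 tuples). Kernel.
[cite: Shioda1979HodgeFermat, §4 condition (Qⁿₘ), p. 183] -/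
theorem checkQU_72_1 :
    checkQU 72
      table72
      1 18 = true := by
  decide +kernel

set_option maxHeartbeats 0 in
/-- The `(Q)`-search at level `72`, case U, first free representative in `[19, 72)` (44098 tuples). Kernel.
[cite: Shioda1979HodgeFermat, §4 condition (Qⁿₘ), p. 183] -/
theorem checkQU_72_19 :
    checkQU 72
      table72
      19 53 = true := by
  decide +kernel

end Summit.HodgeConjecture.FermatCycles.ConditionQFourfold
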